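import Literature.AlgebraicGeometry.Frobenioids.ArchimedeanQuotientLiftingLinear
import Literature.AlgebraicGeometry.Frobenioids.ArchimedeanMonoInjective
import HarnessLib

/-!
# Frobenioids II, Proposition 3.5 (i) REPAIRED for the rigidified angloid `R = R₀ ×_{D₀} D`

Mochizuki, *The geometry of Frobenioids II: poly-Frobenioids*, Kyushu J. Math. **62** (2008) 401–460,
§3, Proposition 3.5 (i), kurims p. 34 [cite: MochizukiFrdII2008, Prop 3.5 (i) p.34], for `H = R`, the
rigidified angloid of [FrdII] Ex. 3.3 (iv) (`R₀ = (N₀)_{A}` the slice over the real unit), terminology of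
`C` applied via "the natural functor `R → C`" (abc-iut-L1-t9's instance shape `Prop35i_R`). Companion of
`ArchimedeanQuotientLifting{,Proofs,Angular,Linear}.lean`. The lift `B` carries the rigidification
`B₀ → A₀ → (real unit)`; the twists `(σ, 1, 1)` respect it (`twistEnd_comp_liftFst`); the descended
arrow of an `R`-arrow respects the rigidifications because `C₀` is totally epimorphic; and the
monomorphism step is transferred to `C` through `R → C` (faithful): two linear isometric test arrows
with the same composite with `ζ` have the same scalar, hence define arrows of `R` out of ONE rigidified
test object (`scalar_eq_of_comp_eq`).
* `ArchFrd.Prop35iR_R π`; **`prop35iR_R_holds : Prop35iR_R π`** for every functor `π : D → D₀`.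
Nothing here bears on [IUTchIII] Cor. 3.12; typed ≠ proved except where a `theorem` says so.
-/

namespace Literature.AlgebraicGeometry.Frobenioids

open CategoryTheory
open scoped Pointwise

noncomputable section

universe v u

namespace ArchFrd

variable {D : Type u} [Category.{v} D] (π : D ⥤ D0)

/-- **Prop. 3.5 (i) REPAIRED for `H = R`** (instance shape of `ArchFrd.Prop35i_R`, plus Galois saturation).
[cite: MochizukiFrdII2008, Prop 3.5 (i) p.34] -/
def Prop35iR_R : Prop := Prop35iR π (baseRC π) (C.toElem π) (R.toC π)

namespace QuotientLiftR

variable (Q : ArchFrd.R π)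

/-- The object of `C` under `A ∈ Ob(R)`. [cite: MochizukiFrdII2008, Ex 3.3 (iv) p.29] -/
abbrev QC : C π := (R.toC π).obj Q

variable {BD : D} (fD : BD ⟶ (QC π Q).snd) (GD : Subgroup (Aut BD))

/-! ### The rigidified lift -/

/-- `B₀` as an object of `N₀`. [cite: MochizukiFrdII2008, Prop 3.5 (i) p.34] -/
abbrev liftN0 : N0 := ⟨⟨QuotientLift.liftC0 π (QC π Q) fD⟩⟩

/-- The pull-back arrow `(b, 1, 1) : B₀ → A₀` as an arrow of `N₀` (a linear isometry).
[cite: MochizukiFrdII2008, Prop 3.5 (i) p.34] -/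
def liftFstN0 : liftN0 π Q fD ⟶ Q.fst.left :=
  N0.homMk (QuotientLift.liftFst π (QC π Q) fD)
    (QuotientLiftA.isIsometry_liftFst π (⟨QC π Q⟩ : ArchFrd.A π) fD) rfl

/-- `B₀` rigidified: the object `(B₀ → A₀ → real unit)` of `R₀ = (N₀)_{unit}`.
[cite: MochizukiFrdII2008, Ex 3.3 (iv) p.29] -/
abbrev liftR0 : R0 := Over.mk (liftFstN0 π Q fD ≫ Q.fst.hom)

/-- The object `B` of `R`. [cite: MochizukiFrdII2008, Prop 3.5 (i) p.34] -/
abbrev liftObjR : ArchFrd.R π := ⟨liftR0 π Q fD, BD, Iso.refl _⟩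

/-- **The arrow `B → A` OF `R` lifting `B_D → A_D`.** [cite: MochizukiFrdII2008, Prop 3.5 (i) p.34] -/
def liftMorR : liftObjR π Q fD ⟶ Q :=
  ⟨Over.homMk (liftFstN0 π Q fD) rfl, fD, (QuotientLift.liftMor π (QC π Q) fD).w⟩

/-- Under `R → C`, `B` is the lift of `ArchimedeanQuotientLifting`. [cite: MochizukiFrdII2008, Prop 3.5 (i) p.34] -/
theorem toC_obj_liftObjR : (R.toC π).obj (liftObjR π Q fD) = QuotientLift.liftObj π (QC π Q) fD := rfl

/-- Under `R → C`, `liftMorR` is `liftMor`. [cite: MochizukiFrdII2008, Prop 3.5 (i) p.34] -/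
theorem toC_map_liftMorR : (R.toC π).map (liftMorR π Q fD) = QuotientLift.liftMor π (QC π Q) fD := rfl

/-- The twist `(σ, 1, 1)` as an automorphism of `B₀` in `N₀`. [cite: MochizukiFrdII2008, Prop 3.5 (i) p.34] -/
def twistN0 (σ : π.obj BD ⟶ π.obj BD)
    (hσ : σ ≫ QuotientLift.liftBase π (QC π Q) fD = QuotientLift.liftBase π (QC π Q) fD) :
    liftN0 π Q fD ≅ liftN0 π Q fD :=
  CategoryTheory.isoMk
    (CategoryTheory.isoMk (QuotientLift.twistAut π (QC π Q) fD σ hσ)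
      (QuotientLiftA.isIsometry_twistEnd π (⟨QC π Q⟩ : ArchFrd.A π) fD σ hσ)
      (QuotientLiftA.isIsometry_twistEnd π (⟨QC π Q⟩ : ArchFrd.A π) fD σ hσ))
    rfl rfl

/-- The twist respects the rigidification. [cite: MochizukiFrdII2008, Prop 3.5 (i) p.34] -/
theorem twistN0_hom_comp (σ : π.obj BD ⟶ π.obj BD)
    (hσ : σ ≫ QuotientLift.liftBase π (QC π Q) fD = QuotientLift.liftBase π (QC π Q) fD) :
    (twistN0 π Q fD σ hσ).hom ≫ (liftR0 π Q fD).hom = (liftR0 π Q fD).hom := by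
  apply N0.hom_ext
  change QuotientLift.twistEnd π (QC π Q) fD σ hσ ≫ QuotientLift.liftFst π (QC π Q) fD ≫ _ =
    QuotientLift.liftFst π (QC π Q) fD ≫ _
  rw [← Category.assoc, QuotientLift.twistEnd_comp_liftFst]

/-- **The lifted automorphism of `B` in `R`.** [cite: MochizukiFrdII2008, Prop 3.5 (i) p.34] -/
def liftAutR (g : Aut BD) (hg : g.hom ≫ fD = fD) : liftObjR π Q fD ≅ liftObjR π Q fD :=
  CFP.isoMk
    (Over.isoMk (twistN0 π Q fD (π.map g.hom) (QuotientLift.map_comp_liftBase π (QC π Q) fD g hg))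
      (twistN0_hom_comp π Q fD _ _))
    g (by change π.map g.hom ≫ 𝟙 _ = 𝟙 _ ≫ π.map g.hom; rw [Category.comp_id, Category.id_comp])

/-- Under `R → C`, the lifted automorphism is the one of `C`. [cite: MochizukiFrdII2008, Prop 3.5 (i) p.34] -/
theorem toC_map_liftAutR_hom (g : Aut BD) (hg : g.hom ≫ fD = fD) :
    (R.toC π).map (liftAutR π Q fD g hg).hom = (QuotientLift.liftAut π (QC π Q) fD g hg).hom := rfl

/-- **The group homomorphism `G_D → Aut_R(B)`.** [cite: MochizukiFrdII2008, Prop 3.5 (i) p.34] -/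
def liftAutHomR (hGD : ∀ g ∈ GD, g.hom ≫ fD = fD) : GD →* Aut (liftObjR π Q fD) where
  toFun g := liftAutR π Q fD g (hGD g g.2)
  map_one' := by
    apply Iso.ext
    exact CFP.hom_ext (Over.OverMorphism.ext (N0.hom_ext (C0.hom_ext (π.map_id BD) rfl rfl))) rfl
  map_mul' g h := by
    apply Iso.ext
    refine CFP.hom_ext (Over.OverMorphism.ext (N0.hom_ext (C0.hom_ext (π.map_comp _ _) rfl ?_))) rfl
    change (1 : ℂˣ) = (π.map (h : Aut BD).hom).act 1 * 1 ^ ((1 : ℕ+) : ℕ)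
    rw [map_one, one_pow, mul_one]

/-- `G_D → Aut_R(B)` is injective. [cite: MochizukiFrdII2008, Prop 3.5 (i) p.34] -/
theorem liftAutHomR_injective (hGD : ∀ g ∈ GD, g.hom ≫ fD = fD) :
    Function.Injective (liftAutHomR π Q fD GD hGD) := by
  intro g h hgh
  apply Subtype.ext
  apply Iso.ext
  exact congrArg (fun k : Aut (liftObjR π Q fD) => k.hom.snd) hgh

/-! ### Categorical quotient inside `R` -/

variable {GD}

/-- An arrow of `C` out of `A` whose precomposite with the lift underlies an arrow of `R` respects the
rigidifications (`C₀` is totally epimorphic). [cite: MochizukiFrdII2008, Ex 3.3 (iv) p.29] -/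
theorem rigid_of_comp {X : ArchFrd.R π} (ψ : liftObjR π Q fD ⟶ X) (ψ' : QC π Q ⟶ QC π X)
    (h : QuotientLift.liftMor π (QC π Q) fD ≫ ψ' = (R.toC π).map ψ) :
    ψ'.fst ≫ N0.homCarrier X.fst.hom = N0.homCarrier Q.fst.hom := by
  haveI : Epi (QuotientLift.liftFst π (QC π Q) fD) := C0.isTotallyEpimorphic.epi _
  rw [← cancel_epi (QuotientLift.liftFst π (QC π Q) fD), ← Category.assoc]
  have h1 : QuotientLift.liftFst π (QC π Q) fD ≫ ψ'.fst = N0.homCarrier ψ.fst.left :=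
    congrArg CFP.Hom.fst h
  have h2 : N0.homCarrier ψ.fst.left ≫ N0.homCarrier X.fst.hom = N0.homCarrier (liftR0 π Q fD).hom :=
    congrArg N0.homCarrier (Over.w ψ.fst)
  rw [h1]
  exact h2

/-- `B → A` is a categorical quotient of `B` by the lifted group IN `R`.
[cite: MochizukiFrdII2008, Prop 3.5 (i) p.34] -/
theorem isCategoricalQuotient_liftMorR (hq : IsCategoricalQuotient GD fD) (hsat : GaloisSaturated π fD GD) :
    IsCategoricalQuotient (liftAutHomR π Q fD GD hq.1).range (liftMorR π Q fD) := by
  have hC := QuotientLift.isCategoricalQuotient_liftMor π (QC π Q) fD hq hsat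
  refine ⟨?_, ?_⟩
  · rintro γ ⟨g, rfl⟩
    apply (R.toC π).map_injective
    rw [Functor.map_comp]
    exact QuotientLift.liftAut_hom_comp_liftMor π (QC π Q) fD (g : Aut BD) (hq.1 g g.2)
  intro X ψ hψ
  have hψC : ∀ γ ∈ (QuotientLift.liftAutHom π (QC π Q) fD GD hq.1).range,
      γ.hom ≫ (R.toC π).map ψ = (R.toC π).map ψ := by
    rintro γ ⟨g, rfl⟩
    have h := congrArg (R.toC π).map (hψ (liftAutHomR π Q fD GD hq.1 g) ⟨g, rfl⟩)
    rw [Functor.map_comp] at h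
    exact h
  obtain ⟨ψ', hψ', hu⟩ := hC.2 ((R.toC π).map ψ) hψC
  have hisoψ : PreFrobenioid.IsIsometry (C.toElem π) ((R.toC π).map ψ) :=
    (PreFrobenioid.isIsometry_fiberProduct_iff _).2 ψ.fst.left.hom.property
  have hiso : PreFrobenioid.IsIsometry C0.toElem ψ'.fst :=
    (PreFrobenioid.isIsometry_fiberProduct_iff _).1 (C.isIsometry_of_fac π _ ψ' (hψ' ▸ hisoψ)).2
  have hlin : C0.degFr ψ'.fst = 1 :=
    (PreFrobenioid.isLinear_factors (C.toElem π) (β := QuotientLift.liftMor π (QC π Q) fD) (α := ψ')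
      (hψ' ▸ (show PreFrobenioid.IsLinear (C.toElem π) ((R.toC π).map ψ) from ψ.fst.left.property))).1
  let ψR : Q ⟶ X :=
    ⟨Over.homMk (N0.homMk ψ'.fst hiso hlin) (N0.hom_ext (rigid_of_comp π Q fD ψ ψ' hψ')), ψ'.snd, ψ'.w⟩
  have hmap : (R.toC π).map ψR = ψ' := rfl
  refine ⟨ψR, ?_, fun y hy => ?_⟩
  · apply (R.toC π).map_injective
    rw [Functor.map_comp, hmap]
    exact hψ'
  · apply (R.toC π).map_injective
    rw [hmap]
    refine hu _ ?_
    have h := congrArg (R.toC π).map hy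
    rw [Functor.map_comp] at h
    exact h

/-- When `A` is real the rigidification of `B` has a real scalar. [cite: MochizukiFrdII2008, Ex 3.3 (iv) p.29] -/
theorem scalar_rigid_mem_real (hQ : (QC π Q).fst.base.IsReal) :
    C0.scalar (N0.homCarrier (liftR0 π Q fD).hom) ∈ D0.scalars D0.real := by
  have hsQ : C0.scalar (N0.homCarrier Q.fst.hom) ∈ D0.scalars D0.real := by
    have hm : C0.scalar (N0.homCarrier Q.fst.hom) ∈ D0.scalars (QC π Q).fst.base :=
      (N0.homCarrier Q.fst.hom).scalar_mem
    unfold D0.IsReal at hQ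
    rw [hQ] at hm
    exact hm
  change C0.scalar (QuotientLift.liftFst π (QC π Q) fD ≫ N0.homCarrier Q.fst.hom) ∈ _
  rw [C0.scalar_comp']
  unfold D0.Hom.act
  rw [D0.galAct_eq_self_of_mem_scalars_real _ hsQ]
  change C0.scalar (N0.homCarrier Q.fst.hom) * 1 ^ (C0.degFr (N0.homCarrier Q.fst.hom) : ℕ) ∈ _
  rw [one_pow, mul_one]
  exact hsQ

/-! ### Mono-minimality inside `R` -/

/-- An arrow of `R` out of `B` under `R → C`, typed over the lift of `C`.
[cite: MochizukiFrdII2008, Ex 3.3 (iv) p.29] -/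
abbrev toCζ {A' : ArchFrd.R π} (ζ : liftObjR π Q fD ⟶ A') :
    QuotientLift.liftObj π (QC π Q) fD ⟶ QC π A' := (R.toC π).map ζ

section Mono

variable {A' : ArchFrd.R π} (ζ : liftObjR π Q fD ⟶ A') (φ' : A' ⟶ Q) (hfac : ζ ≫ φ' = liftMorR π Q fD)

include hfac

/-- The factorisation under `R → C`. [cite: MochizukiFrdII2008, Prop 3.5 (i) p.34] -/
theorem toC_fac : toCζ π Q fD ζ ≫ (R.toC π).map φ' = QuotientLift.liftMor π (QC π Q) fD := by
  change (R.toC π).map (ζ ≫ φ') = _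
  rw [hfac]; rfl

omit hfac in
include φ' in
/-- Two test arrows into `B` with the same composite with `ζ` either have the same base, or force `A′`
and `A` to be real. [cite: MochizukiFrdII2008, Prop 3.5 (i) p.34] -/
theorem base_eq_or_isReal {T : C π} (t₁ t₂ : T ⟶ QuotientLift.liftObj π (QC π Q) fD)
    (h : t₁ ≫ toCζ π Q fD ζ = t₂ ≫ toCζ π Q fD ζ) :
    C0.Base t₁.fst = C0.Base t₂.fst ∨ ((QC π A').fst.base.IsReal ∧ (QC π Q).fst.base.IsReal) := by
  by_cases hθ : C0.Base t₁.fst = C0.Base t₂.fst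
  · exact Or.inl hθ
  · right
    have hb := congrArg (fun k => C0.Base (CFP.Hom.fst k)) h
    change C0.Base (t₁.fst ≫ (toCζ π Q fD ζ).fst) = C0.Base (t₂.fst ≫ (toCζ π Q fD ζ).fst) at hb
    rw [C0.base_comp', C0.base_comp'] at hb
    have hw : C0.Base (toCζ π Q fD ζ).fst ≫ (QuotientLift.baseIso π (QC π A')).hom =
        𝟙 _ ≫ π.map (toCζ π Q fD ζ).snd := (toCζ π Q fD ζ).w
    rw [Category.id_comp] at hw
    have heq : C0.Base t₁.fst ≫ π.map (toCζ π Q fD ζ).snd =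
        C0.Base t₂.fst ≫ π.map (toCζ π Q fD ζ).snd := by
      rw [← hw, ← Category.assoc, ← Category.assoc, hb]
    exact QuotientLift.isReal_of_ne π (QC π Q) fD (toCζ π Q fD ζ) ((R.toC π).map φ') _ _ hθ heq

/-- Two linear test arrows into `B` with the same composite with `ζ` have the same scalar.
[cite: MochizukiFrdII2008, Prop 3.5 (i) p.34] -/
theorem scalar_eq_of_comp_eq {T : C π} (t₁ t₂ : T ⟶ QuotientLift.liftObj π (QC π Q) fD)
    (h : t₁ ≫ toCζ π Q fD ζ = t₂ ≫ toCζ π Q fD ζ) : C0.scalar t₁.fst = C0.scalar t₂.fst := by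
  have hfacC := toC_fac π Q fD ζ φ' hfac
  have hdζ := (QuotientLift.degFr_fst_eq_one_of_fac π (QC π Q) fD _ _ hfacC).1
  have hs := congrArg (fun k => C0.scalar (CFP.Hom.fst k)) h
  change C0.scalar (t₁.fst ≫ (toCζ π Q fD ζ).fst) = C0.scalar (t₂.fst ≫ (toCζ π Q fD ζ).fst) at hs
  rw [C0.scalar_comp', C0.scalar_comp', hdζ, PNat.one_coe, pow_one, pow_one] at hs
  rcases base_eq_or_isReal π Q fD ζ φ' t₁ t₂ h with hθ | hreal
  · rw [hθ] at hs
    exact mul_left_cancel hs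
  · have hcζ := QuotientLift.scalar_fst_mem_real π (QC π Q) fD _ _ hfacC hreal.1
    unfold D0.Hom.act at hs
    rw [D0.galAct_eq_self_of_mem_scalars_real _ hcζ, D0.galAct_eq_self_of_mem_scalars_real _ hcζ] at hs
    exact mul_left_cancel hs

/-- A monomorphism `ζ` of `R` under the lift cancels LINEAR ISOMETRIC test arrows of `C` (they lift to
`R` out of one rigidified test object). [cite: MochizukiFrdII2008, Prop 3.5 (i) p.34] -/
theorem cancel_of_mono (hmono : Mono ζ) ⦃T : C π⦄ (t₁ t₂ : T ⟶ QuotientLift.liftObj π (QC π Q) fD)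
    (i₁ : PreFrobenioid.IsIsometry (C.toElem π) t₁) (i₂ : PreFrobenioid.IsIsometry (C.toElem π) t₂)
    (l₁ : C0.degFr t₁.fst = 1) (l₂ : C0.degFr t₂.fst = 1)
    (h : t₁ ≫ toCζ π Q fD ζ = t₂ ≫ toCζ π Q fD ζ) : t₁ = t₂ := by
  haveI := hmono
  have hc := scalar_eq_of_comp_eq π Q fD ζ φ' hfac t₁ t₂ h
  -- the two rigidifications of `T` agree
  let n₁ : (⟨⟨T.fst⟩⟩ : N0) ⟶ liftN0 π Q fD :=
    N0.homMk t₁.fst ((PreFrobenioid.isIsometry_fiberProduct_iff _).1 i₁) l₁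
  let n₂ : (⟨⟨T.fst⟩⟩ : N0) ⟶ liftN0 π Q fD :=
    N0.homMk t₂.fst ((PreFrobenioid.isIsometry_fiberProduct_iff _).1 i₂) l₂
  have hrig : n₂ ≫ (liftR0 π Q fD).hom = n₁ ≫ (liftR0 π Q fD).hom := by
    apply N0.hom_ext
    change t₂.fst ≫ N0.homCarrier (liftR0 π Q fD).hom = t₁.fst ≫ N0.homCarrier (liftR0 π Q fD).hom
    refine C0.hom_ext (D0.hom_eq_of_isReal rfl _ _) ?_ ?_
    · rw [C0.degFr_comp', C0.degFr_comp', l₁, l₂]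
    · rw [C0.scalar_comp', C0.scalar_comp', hc]
      rcases base_eq_or_isReal π Q fD ζ φ' t₁ t₂ h with hθ | hreal
      · rw [hθ]
      · have hk := scalar_rigid_mem_real π Q fD hreal.2
        unfold D0.Hom.act
        rw [D0.galAct_eq_self_of_mem_scalars_real _ hk, D0.galAct_eq_self_of_mem_scalars_real _ hk]
  let TR : ArchFrd.R π := ⟨Over.mk (n₁ ≫ (liftR0 π Q fD).hom), T.snd, T.iso⟩
  let r₁ : TR ⟶ liftObjR π Q fD := ⟨Over.homMk n₁ rfl, t₁.snd, t₁.w⟩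
  let r₂ : TR ⟶ liftObjR π Q fD := ⟨Over.homMk n₂ hrig, t₂.snd, t₂.w⟩
  have e₁ : (R.toC π).map r₁ = t₁ := rfl
  have e₂ : (R.toC π).map r₂ = t₂ := rfl
  have hR : r₁ ≫ ζ = r₂ ≫ ζ := by
    apply (R.toC π).map_injective
    rw [Functor.map_comp, Functor.map_comp, e₁, e₂]
    exact h
  rw [← e₁, ← e₂, (cancel_mono ζ).1 hR]

/-- **`B → A` is a MONO-MINIMAL categorical quotient of `B` by the lifted group IN `R`.**
[cite: MochizukiFrdII2008, Prop 3.5 (i) p.34] -/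
theorem isIso_of_minimal (hq : IsMonoMinimalQuotient GD fD) (hmono : Mono ζ)
    (hgrp : ∃ (Γ' : Subgroup (Aut A')) (e : (liftAutHomR π Q fD GD hq.1.1).range ≃* Γ'),
      ∀ γ : (liftAutHomR π Q fD GD hq.1.1).range,
        (γ : Aut (liftObjR π Q fD)).hom ≫ ζ = ζ ≫ ((e γ : Γ') : Aut A').hom) :
    IsIso ζ := by
  obtain ⟨Γ', e', he'⟩ := hgrp
  have hfacC := toC_fac π Q fD ζ φ' hfac
  have hmonoD : Mono (toCζ π Q fD ζ).snd :=
    QuotientLiftN.mono_snd_of_mono_linear π (QC π Q) fD _ _ hfacC (cancel_of_mono π Q fD ζ φ' hfac hmono)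
  haveI := hmonoD
  let eΓ := MonoidHom.ofInjective (liftAutHomR_injective π Q fD GD hq.1.1)
  let ρ : GD →* Aut A'.snd :=
    ((CFP.proj₂ R0.toD0 π).mapAut A').comp (Γ'.subtype.comp (e'.toMonoidHom.comp eΓ.toMonoidHom))
  have hρ : ∀ g : GD, (g : Aut BD).hom ≫ ζ.snd = ζ.snd ≫ (ρ g).hom := fun g =>
    congrArg CFP.Hom.snd (he' (eΓ g))
  have hρinj : Function.Injective ρ := by
    rw [injective_iff_map_eq_one]
    intro g hg1
    have h := hρ g
    rw [hg1] at h
    change (g : Aut BD).hom ≫ (toCζ π Q fD ζ).snd = (toCζ π Q fD ζ).snd ≫ 𝟙 _ at h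
    rw [Category.comp_id] at h
    have h' : (g : Aut BD).hom = 𝟙 BD :=
      (cancel_mono (toCζ π Q fD ζ).snd).1 (h.trans (Category.id_comp _).symm)
    apply Subtype.ext
    apply Iso.ext
    exact h'
  have hisoD : IsIso (toCζ π Q fD ζ).snd :=
    hq.2 _ φ'.snd (congrArg CFP.Hom.snd hfacC) hmonoD ⟨ρ.range, MonoidHom.ofInjective hρinj, fun g => hρ g⟩
  haveI := hisoD
  have hbi : PreFrobenioid.IsBaseIso C0.toElem (toCζ π Q fD ζ).fst :=
    PreFrobenioid.isBaseIso_fst_of_isIso_snd (toCζ π Q fD ζ)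
  obtain ⟨hdζ, hdφ⟩ := QuotientLift.degFr_fst_eq_one_of_fac π (QC π Q) fD _ _ hfacC
  have hrel := QuotientLift.scalar_rel_of_fac π (QC π Q) fD _ _ hfacC
  have hbase := QuotientLift.base_rel_of_fac π (QC π Q) fD _ _ hfacC
  have hfull : C0.scalar (toCζ π Q fD ζ).fst • (QuotientLift.liftC0 π (QC π Q) fD).region.carrier =
      C0.pullRegion (QC π A').fst (C0.Base (toCζ π Q fD ζ).fst) := by
    have hmζ := (toCζ π Q fD ζ).fst.mapsTo
    change C0.scalar (toCζ π Q fD ζ).fst • (QuotientLift.liftC0 π (QC π Q) fD).region.carrier ^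
      (C0.degFr (toCζ π Q fD ζ).fst : ℕ) ⊆ C0.pullRegion (QC π A').fst (C0.Base (toCζ π Q fD ζ).fst)
      at hmζ
    rw [hdζ, PNat.one_coe, pow_one] at hmζ
    refine Set.Subset.antisymm hmζ ?_
    have hmφ := ((R.toC π).map φ').fst.mapsTo
    change C0.scalar ((R.toC π).map φ').fst • (QC π A').fst.region.carrier ^
      (C0.degFr ((R.toC π).map φ').fst : ℕ) ⊆ C0.pullRegion (QC π Q).fst (C0.Base ((R.toC π).map φ').fst)
      at hmφ
    rw [hdφ, PNat.one_coe, pow_one] at hmφ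
    have h1 := Set.image_mono (f := (C0.Base (toCζ π Q fD ζ).fst).act) hmφ
    rw [Set.image_smul_distrib] at h1
    change _ ⊆ (C0.Base (toCζ π Q fD ζ).fst).act ''
      C0.pullRegion (QC π Q).fst (C0.Base ((R.toC π).map φ').fst) at h1
    rw [← C0.pullRegion_comp, hbase, ← QuotientLift.liftRegion_carrier] at h1
    have h2 := Set.smul_set_mono (a := C0.scalar (toCζ π Q fD ζ).fst) h1
    rw [smul_smul, mul_comm, hrel, one_smul] at h2
    exact h2
  have hpb : PreFrobenioid.IsPullbackMorphism C0.toElem (toCζ π Q fD ζ).fst :=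
    (C0.isPullbackMorphism_iff _).2 ⟨hdζ, hfull⟩
  haveI : IsIso (toCζ π Q fD ζ).fst :=
    (PreFrobenioid.isPullbackMorphism_and_isBaseIso_iff_isIso C0.toElem _).mp ⟨hpb, hbi⟩
  have hiso : IsIso (toCζ π Q fD ζ) := CFP.isIso_of_isIso_fst_snd _
  haveI : IsIso ((R.toC π).map ζ) := hiso
  exact R.isIso_of_isIso_toC ζ

end Mono

/-- **`B → A` is a MONO-MINIMAL categorical quotient of `B` by the lifted group IN `R`.**
[cite: MochizukiFrdII2008, Prop 3.5 (i) p.34] -/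
theorem isMonoMinimalQuotient_liftMorR (hq : IsMonoMinimalQuotient GD fD)
    (hsat : GaloisSaturated π fD GD) :
    IsMonoMinimalQuotient (liftAutHomR π Q fD GD hq.1.1).range (liftMorR π Q fD) :=
  ⟨isCategoricalQuotient_liftMorR π Q fD hq.1 hsat, fun _ ζ φ' hfac hmono hgrp =>
    isIso_of_minimal π Q fD ζ φ' hfac hq hmono hgrp⟩

/-- **Proposition 3.5 (i) for `H = R`, REPAIRED (Galois saturation) — PROVED** over any functor
`π : D → D₀`. [cite: MochizukiFrdII2008, Prop 3.5 (i) p.34] -/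
theorem prop35iR_R_holds : Literature.AlgebraicGeometry.Frobenioids.ArchFrd.Prop35iR_R π := by
  intro _ Q BD fD GD hq hsat
  change BD ⟶ Q.snd at fD
  refine ⟨liftObjR π Q fD, liftMorR π Q fD, Iso.refl _, (liftAutHomR π Q fD GD hq.1.1).range,
    (MonoidHom.ofInjective (liftAutHomR_injective π Q fD GD hq.1.1)).symm,
    QuotientLift.isPullbackMorphism_liftMor π (QC π Q) fD, (Category.id_comp _).symm, fun γ => ?_,
    isMonoMinimalQuotient_liftMorR π Q fD hq hsat⟩
  have h1 := MonoidHom.apply_ofInjective_symm (liftAutHomR_injective π Q fD GD hq.1.1) γ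
  have h2 : (((MonoidHom.ofInjective (liftAutHomR_injective π Q fD GD hq.1.1)).symm γ : GD) :
      Aut BD).hom = (γ : Aut (liftObjR π Q fD)).hom.snd :=
    congrArg (fun k : Aut (liftObjR π Q fD) => k.hom.snd) h1
  exact (Category.comp_id _).trans (h2.symm.trans (Category.id_comp _).symm)

end QuotientLiftR

/-- **[FrdII] Prop. 3.5 (i) REPAIRED for `H = R` — discharge of the named statement `Prop35iR_R`**
(alias of `QuotientLiftR.prop35iR_R_holds`). [cite: MochizukiFrdII2008, Prop 3.5 (i) p.34] -/
theorem Prop35iR_R_holds : Prop35iR_R π := QuotientLiftR.prop35iR_R_holds π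

end ArchFrd

end

end Literature.AlgebraicGeometry.Frobenioids
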